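import Literature.AnabelianGeometry.AbsoluteAnabelian.MonoidKummerMapsIdRigidTFInjProofs
import Literature.AnabelianGeometry.AbsoluteAnabelian.MonoidKummerMapsIdRigidProofs
import Literature.AnabelianGeometry.AbsoluteAnabelian.SlimTransport
import Literature.AnabelianGeometry.AbsoluteAnabelian.MLFSlimKummerProofs
import Literature.NumberTheory.GaloisRepresentations.CohomologicalDimension
import Literature.NumberTheory.PAdicHodge.PadicBaseField
import Literature.NumberTheory.PAdicHodge.AxSenTate

/-!
# [AbsTopIII] Prop 3.2 (iv) id-rigidity — an UNCONDITIONAL instance: the pairs of MONO-ANALYTIC TYPE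
# (proof-only; abc-iut cell, sub-DAG [AbsTopIII] Prop 3.2 (i)(iv), non-vacuity witness for rows
# P32.iv.L14 / L17 / L14-TF / L17-TF)

S. Mochizuki, *Topics in Absolute Anabelian Geometry III*, §3, Prop. 3.2 (iv) p. 72 (bib key
`MochizukiAbsTopIII2015`) deduces centre-freeness and id-rigidity «immediately from the slimness of `Π`
[cf., e.g., [Mzk20], Proposition 2.3, (ii)]» for pairs OF HYPERBOLIC ORBICURVE / STRICTLY BELYI TYPE.  The
tree's rows (`prop32iv_idRigid_TM_of_isSlimGroup`, `prop32iv_idRigidTF_of_isSlimGroup'`,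
`autPairCenterFree_of_isSlimGroup`, `autFieldPairCenterFree_of_isSlimGroup'`) are accordingly CONDITIONAL on
a slimness input for the hypothesis predicate `H`.  THIS FILE shows that input is met — with NO hypothesis —
by the predicate «of mono-analytic type» of Def. 3.1 (ii) (`IsOfMonoAnalyticTypeMonoid .TM`,
`IsOfMonoAnalyticTypeField`: `Π_k ↠ G_k` an isomorphism of topological groups), because `G_k` is slim:
[AbsAnab] Thm. 1.1.1 (ii), PROVED in the tree (`galoisMLF_slim_holds`, abc-iut-L4-d2).

* `MLFClosure.isSlimGroup_algEquiv` — `Gal(k̄/k)` is slim for every MLF closure datum `(k, k̄)` (the tree's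
  `galoisMLF_slim_holds` for the canonical `ℚ_p`-structure of the local field `k`,
  `LocalField.padicAlgebra` / `PadicBase.instFiniteDimensional`, transported to any algebraic closure by
  `algEquivContinuousMulEquivAbsoluteGaloisGroup` and `isSlimGroup_of_continuousMulEquiv`);
* `ModelMLFGaloisData.isSlimGroup_of_monoAnalytic`, `isSlimGroup_of_isOfMonoAnalyticTypeMonoid_TM`,
  `isSlimGroup_of_isOfMonoAnalyticTypeField` — `Π` is slim for pairs of mono-analytic type;
* UNCONDITIONAL: `autPairCenterFree_monoAnalytic`, `prop32iv_idRigid_TM_monoAnalytic :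
  Prop32iv_idRigid .TM (IsOfMonoAnalyticTypeMonoid .TM)`, `autFieldPairCenterFree_monoAnalytic`,
  `prop32iv_idRigidTF_monoAnalytic : Prop32iv_idRigidTF IsOfMonoAnalyticTypeField` — the full subcategories
  `𝒞^{MLF-ma}_TM`, `𝒞^{MLF-ma}_TF` of pairs of mono-analytic type are id-rigid.

HONEST FRAMING: mono-analytic type is NOT hyperbolic orbicurve type — these are true statements about OUR
typed categories witnessing that the conditional rows are non-vacuous (and giving the first hypothesis-free
instance of the printed mechanism «slim ⇒ centre-free ⇒ id-rigid»); the printed clauses for «hyp»/«sB» remain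
conditional on [Mzk20] Prop. 2.3 (ii).  Nothing here bears on [IUTchIII] Cor. 3.12, and nothing here asserts
that abc is proved or refuted.
-/

namespace Literature.AnabelianGeometry.AbsoluteAnabelian

open _root_.ValuativeRel
open Literature.AlgebraicGeometry.Frobenioids (IsSlimGroup)
open Literature.NumberTheory.GaloisRepresentations
open Literature.NumberTheory.PAdicHodge

noncomputable section

/-! ### `G_k` is slim, for the Galois group of any algebraic closure of a local field of characteristic `0` -/

/-- **[AbsAnab] Thm 1.1.1 (ii) for MLF closure data**: `Gal(k̄/k)` is slim, for every non-archimedean local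
field `k` of characteristic `0` and every algebraic closure `k̄` (the tree's `galoisMLF_slim_holds`, read through
the canonical `ℚ_p`-algebra structure of `k`, `p` the residue characteristic, and transported from
`Gal(AlgebraicClosure k / k)` to `Aut_k(k̄)`). [cite: MochizukiAbsAnab2004, Thm 1.1.1 (ii) p.6] -/
theorem MLFClosure.isSlimGroup_algEquiv (C : MLFClosure.{0}) : IsSlimGroup (C.K ≃ₐ[C.k] C.K) := by
  obtain ⟨p, hp, hpv⟩ := exists_prime_valuation_lt_one (F := C.k)
  haveI : Fact p.Prime := ⟨hp⟩
  letI : Algebra ℚ_[p] C.k := LocalField.padicAlgebra C.k p hpv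
  haveI : FiniteDimensional ℚ_[p] C.k := PadicBase.instFiniteDimensional (F := C.k) (p := p) hpv
  have h : IsSlimGroup (Field.absoluteGaloisGroup C.k) := galoisMLF_slim_holds p C.k
  exact isSlimGroup_of_continuousMulEquiv (algEquivContinuousMulEquivAbsoluteGaloisGroup C.k C.K).symm h

/-! ### `Π` is slim for pairs of mono-analytic type -/

/-- For model data of MONO-ANALYTIC TYPE (`ε_k : Π_k → G_k` bijective and open, Def 3.1 (ii)), `Π_k` is slim
(`ε_k` is then an isomorphism of topological groups onto the slim group `G_k`).
[cite: MochizukiAbsTopIII2015, Definition 3.1 (ii) p.67] -/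
theorem ModelMLFGaloisData.isSlimGroup_of_monoAnalytic (C : MLFClosure.{0}) (D : ModelMLFGaloisData C.k C.K)
    (h : Function.Bijective D.aug ∧ IsOpenMap D.aug) : IsSlimGroup D.Pi := by
  let t : D.Pi ≃ₜ (C.K ≃ₐ[C.k] C.K) :=
    (Equiv.ofBijective D.aug h.1).toHomeomorphOfContinuousOpen D.continuous_aug h.2
  let e : D.Pi ≃ₜ* (C.K ≃ₐ[C.k] C.K) :=
    { MulEquiv.ofBijective D.aug h.1 with
      continuous_toFun := D.continuous_aug
      continuous_invFun := t.symm.continuous }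
  exact isSlimGroup_of_continuousMulEquiv e.symm C.isSlimGroup_algEquiv

/-- `Π` is slim for every MLF-Galois `TM`-pair OF MONO-ANALYTIC TYPE.
[cite: MochizukiAbsTopIII2015, Definition 3.1 (ii) p.67] -/
theorem isSlimGroup_of_isOfMonoAnalyticTypeMonoid_TM (P : GaloisMonoidPair.{0})
    (hP : IsOfMonoAnalyticTypeMonoid .TM P) : IsSlimGroup P.Pi := by
  obtain ⟨C, D, Q, hD, hQ, ⟨ι⟩⟩ := hP.exists_model
  rw [ModelMLFGaloisData.monoidPair_TM, Option.some.injEq] at hQ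
  subst hQ
  exact isSlimGroup_of_continuousMulEquiv ι.isoPi (D.isSlimGroup_of_monoAnalytic C hD)

/-- `Π` is slim for every MLF-Galois `TF`-pair OF MONO-ANALYTIC TYPE.
[cite: MochizukiAbsTopIII2015, Definition 3.1 (ii) p.67] -/
theorem isSlimGroup_of_isOfMonoAnalyticTypeField (P : GaloisFieldPair.{0}) (hP : IsOfMonoAnalyticTypeField P) :
    IsSlimGroup P.Pi := by
  obtain ⟨C, D, hD, ⟨ι⟩⟩ := hP.exists_model
  exact isSlimGroup_of_continuousMulEquiv ι.isoPi (D.isSlimGroup_of_monoAnalytic C hD)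

/-! ### Unconditional centre-freeness and id-rigidity at mono-analytic type -/

/-- **`Aut_{𝒞^MLF_TM}((Π ↷ M))` is centre-free for every `TM`-pair of mono-analytic type — UNCONDITIONAL**
(abc-iut-L4-t2's schema `AutPairCenterFree` at `H =` «of mono-analytic type»; abc-iut-L6-t13's
`autPairCenterFree_of_isSlimGroup` fed with the slimness of `G_k`). [cite: MochizukiAbsTopIII2015, Proposition 3.2 (iv) p.72] -/
theorem autPairCenterFree_monoAnalytic : AutPairCenterFree (IsOfMonoAnalyticTypeMonoid .TM) :=
  autPairCenterFree_of_isSlimGroup fun P _ hP => isSlimGroup_of_isOfMonoAnalyticTypeMonoid_TM P hP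

/-- **The full subcategory `𝒞^{MLF-ma}_TM` of `TM`-pairs of mono-analytic type is id-rigid — UNCONDITIONAL**
(`Prop32iv_idRigid .TM` at `H =` «of mono-analytic type»: the printed mechanism «slim ⇒ centre-free ⇒ id-rigid»
of Prop 3.2 (iv) with the slimness of `G_k` = [AbsAnab] Thm 1.1.1 (ii), a tree theorem).  Non-vacuity witness
for row P32.iv.L17; not itself a printed clause (print: «hyp», «sB»).
[cite: MochizukiAbsTopIII2015, Proposition 3.2 (iv) p.72] -/
theorem prop32iv_idRigid_TM_monoAnalytic : Prop32iv_idRigid.{0} .TM (IsOfMonoAnalyticTypeMonoid .TM) :=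
  prop32iv_idRigid_TM_of_isSlimGroup fun P _ hP => isSlimGroup_of_isOfMonoAnalyticTypeMonoid_TM P hP

/-- **`Aut_{𝒞^MLF_TF}((Π ↷ k̄))` is centre-free for every `TF`-pair of mono-analytic type — UNCONDITIONAL**
(`AutFieldPairCenterFree` at `H =` «of mono-analytic type», via `autFieldPairCenterFree_of_isSlimGroup'`).
[cite: MochizukiAbsTopIII2015, Proposition 3.2 (iv) p.72] -/
theorem autFieldPairCenterFree_monoAnalytic : AutFieldPairCenterFree IsOfMonoAnalyticTypeField :=
  autFieldPairCenterFree_of_isSlimGroup' fun P _ hP => isSlimGroup_of_isOfMonoAnalyticTypeField P hP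

/-- **The full subcategory `𝒞^{MLF-ma}_TF` of `TF`-pairs of mono-analytic type is id-rigid — UNCONDITIONAL**
(`Prop32iv_idRigidTF` at `H =` «of mono-analytic type»).  Non-vacuity witness for row P32.iv.L17-TF.
[cite: MochizukiAbsTopIII2015, Proposition 3.2 (iv) p.72] -/
theorem prop32iv_idRigidTF_monoAnalytic : Prop32iv_idRigidTF.{0} IsOfMonoAnalyticTypeField :=
  prop32iv_idRigidTF_of_isSlimGroup' fun P _ hP => isSlimGroup_of_isOfMonoAnalyticTypeField P hP

end

end Literature.AnabelianGeometry.AbsoluteAnabelian
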